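import Summits.QuantumFields.BalabanUV.Beta.D1BFx.SectorRecut
import Summits.QuantumFields.BalabanUV.Beta.D1BFx.RankOneBubble

/-!
# `BalabanUV.Beta.D1BFx.LocalVertexForm` — road «BF-x» for binder row D1, slot (K), END row `hGrp gN`, «GN-T12 ∕ FRAME»: A LOCAL LIST VERTEX
# AGAINST A RANK-ONE PARTNER — `biBubble A (realK z z L) B (φ ⊗ ψ)` IS THE VERTEX FORM `Σ_{(x,y,m)∈L} Σ_{g f} m g f · (ψA)(z+x, g) · (Bφ)(z+y, f)`,
# the graded moves of the list land on the two leg ends as lattice differences, and a grading-1 list is bounded by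
# `K · (Φ₁·Γ₀ + Φ₀·Γ₁ + Φ₁·Γ₁)` from window bounds `Φ₀ ∕ Φ₁` (values ∕ unit differences of the row end) and `Γ₀ ∕ Γ₁` (column end) — the frame of the
# six `SbT ⊗ ·` ∕ `· ⊗ SbT` pieces of the gluon needle rows T₁ ∕ T₂ (`GluonNeedleGlueT12.h₁∕h₂_of_pieces`)

HONEST DEPENDENCY (cell records, verbatim): «continuum YM on T⁴ ⇐ BetaPertH ∧ nine spine estimates (0/9 proved); BetaPertH ⇐ (D1) ∧ (D4) ∧
CAP+tail; G-an2-4 gates asym, D1 and NE2/3/4.»  HONEST FRAMING (cell contract, verbatim): «discharging `BetaPertH` makes Bałaban's UV stability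
UNCONDITIONAL — a real constructive-QFT result; it is NOT the continuum limit and NOT the Clay problem.»  THIS MODULE DISCHARGES NOTHING of the
wall: definitions with bodies ([our objects] the bond-function shift ∕ difference ∕ iterated difference `shiftB` ∕ `fdiffB` ∕ `iterΔ`, the list vertex form
`vtx`, the finite-support vertex form `vform`, the unfolded term `VTerm` with `eval`) and [folklore] finite-sum bookkeeping: the identification of the
mixed two-leg bubble with the vertex form (ONE summability hypothesis on the row end `x ↦ Σ_a ψ x a · A x s a g`, used once in `Summable.tsum_finsetSum`;
everything else is `tsum_eq_sum` over the list's finite supports and the unconditional pull-outs of `RankOneBubble`), the list moves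
(`vtx_rowSh∕colSh∕rowDiff∕colDiff∕append∕smulS`), an3's `Graded` induction run ONCE MORE with one vertex (`exists_vterms_of_graded`: every derivation step
recorded as a unit step at one of the two ends), the window estimate for grading 1, and its instance for the transverse-completed Wilson sector
`SbT κ u = realK u u (reixStn ιU (vec₀ κ ++ rem₀ κ))` (grading 1: `graded_vec₀`, `graded_rem₀.weaken`).  No `def … : Prop`, nothing cited, no
hypothesis is a printed statement, 0 sorry.  Asserts NO bound on any table of the road.  Root-level binders hW ∕ hR-sockets ∕ hSX-socket ∕ D1Tel ∕
D1Rep — 0 discharged; (K) NOT closed; NOT D1, NOT `BetaPertH`, NOT continuum, NOT Clay.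

ABSOLUTE RULE (cell charter, verbatim): «No internally-minted statement may enter as a cited fact. Every hypothesis is either kernel-proved in
this package or a verbatim quotation of a PUBLISHED theorem with page reference. The manuscript(s) under audit are NOT citable for their own
disputed steps — they are the thing under adjudication; programme-internal (2001/route/tribunal) claims are never citable.»

WHY (owner records `HOME/b2b-balaban-beta-d1-p2/GLUON-NEEDLE-ROWS.md` v0.2 «GN-CELLS», rows «T₁∕T₂ P-piece `SbT ⊗ proj`», «K-piece», «Q̇-piece»; an3-g57
`N36-SPLIT.v1.md` §3′ (4) «against the LOCAL `SbT` the partner vertex supplies lattice differences on the legs»).  After `GluonNeedleGlueT12` the rows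
T₁∕T₂ are three n-uniform cell bounds each, `|cellSum n a SbT (piece) μ ν| ≤ C`, whose word is `biBubble (Ga) (SbT μ (b+w)) (Ga) (piece ν b)` with
`piece` a RANK-ONE bond kernel (`RankOneBubbleJets.dJetSw_eq_outer_sub`, `dSw_tensor`, `NeedleNdlShape.ndlPiece_eq_outer`) and `SbT μ (b+w)` a
REALISED LOCATED-PAIR LIST of grading 1 (`CrossERestLists`: `SbE = VEC + DIVₐ + REMₐ`, `SbT = SbE − DIVₐ`).  Leaf-03-g12's `BiBubbleTable` ∕
`GradedBiBubbleTerms` unfold TWO list vertices; here ONE list vertex meets a rank-one partner, and the list's one difference must land on a leg END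
(`(ψA)(·)` or `(Bφ)(·)`) — without it the cell is short by `n¹` (bi-localisation alone gives `Σ_w |w|²·nrm(w)⁻²·n⁻³ ≍ n`).
* §1 [our objects] `shiftB`, `fdiffB`, `iterΔ`, `vtx`; [folklore] `iterΔ_shiftB`, `vtx_append∕smulS∕rowSh∕colSh∕sub_left∕sub_right∕rowDiff∕colDiff`.
* §2 [our object] `vform`; [folklore] `applyK_comp_eq_vform`, **`biBubble_outer_right_eq_vform`**, `vform_realK`, **`biBubble_realK_outer`**
  (`biBubble A (realK z z L) B (outer φ ψ) = vtx z L (applyKT ψ A) (applyK B φ)`).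
* §3 [our object] `VTerm`; [folklore] **`exists_vterms_of_graded`** (`Graded n L →` a term list with `≥ n` unit steps per term evaluating `vtx z L` for all `z F G`).
* §4 [folklore] `abs_iterΔ_le`, **`exists_vtx_bound_of_graded_one`** (`∃ K R, |vtx z L F G| ≤ K·(Φ₁Γ₀ + Φ₀Γ₁ + Φ₁Γ₁)` from window bounds of radius `R`).
* §5 [folklore] `graded_reixStn`, `SbT_eq_realK`, `graded_one_SbT_list`, **`exists_SbT_outer_bound`** (the frame of the six T₁∕T₂ pieces).
NOT HERE (honest): any letter (leg profiles, `kC`, …), any (1.22) sum, any cell bound; the mirror placement `biBubble A (outer) B (realK)` (T₂) is the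
transpose bookkeeping of a later file.  Unit `b2b-balaban-beta-d1-p2` (gen 10), road «BF-x» OWNER; `LEAVES-BFx.md` row (N) «GN-T12 ∕ FRAME».
-/

noncomputable section

namespace Summit.QuantumFields.BalabanUV.Beta.D1BFx.LocalVertexForm

open Finset
open scoped BigOperators
open Literature.MathematicalPhysics.QuantumFieldTheory.Balaban1983to89
open Literature.MathematicalPhysics.QuantumFieldTheory.Balaban1983to89.Beta
open ExpKernelCalculus (Site MKer comp tr)
open DyadicShell (Pt supNorm)
open BubbleTransfer (unitVec)
open GradedBubbles (LP Stn rowSh colSh smulS rowDiff colDiff Graded IsStep)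
open Summit.QuantumFields.BalabanUV.Beta.D1BFx.FiniteStencilCalculus (elemK elemK_apply comp_eq_sum_of_rowSupp comp_eq_zero_of_colSupp_right)
open Summit.QuantumFields.BalabanUV.Beta.D1BFx.StencilRealisation (realK realK_nil realK_cons realK_rowSupp realK_colSupp)
open Summit.QuantumFields.BalabanUV.Beta.D1BFx.WilsonStencilRealised (reixStn ιU reixStn_nil reixStn_cons realK_append)
open Summit.QuantumFields.BalabanUV.Beta.D1BFx.ColourlessAntisymmetry (reixStn_append reixStn_smulS)
open Summit.QuantumFields.BalabanUV.Beta.D1BFx.CrossERestLists (vec₀ rem₀ div₀ graded_vec₀ graded_rem₀ SbE_eq_realK_lists)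
open Summit.QuantumFields.BalabanUV.Beta.D1BFx.SectorRecut (SbT divK SbT_apply)
open Summit.QuantumFields.BalabanUV.Beta.D1BFx.PackedKernelSplit (biBubble)
open Summit.QuantumFields.BalabanUV.Beta.D1BFx.RankOneBubble (outer applyK applyKT pairing comp_outer_right tr_outer applyK_apply applyKT_apply
  pairing_def)

variable {I : Type*} [Fintype I]

/-! ## §1 Bond-function shifts and differences; the list vertex form and its moves -/

section Moves

omit [Fintype I] in
/-- [our object] Shift of a bond function: `shiftB a F x g = F (x + a) g`.  A definition; asserts nothing. -/
def shiftB (a : Pt) (F : Pt → I → ℝ) : Pt → I → ℝ := fun x g => F (x + a) g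

omit [Fintype I] in
/-- [our object] Forward difference of a bond function along `a`: `fdiffB a F x g = F (x + a) g − F x g`.  A definition; asserts nothing. -/
def fdiffB (a : Pt) (F : Pt → I → ℝ) : Pt → I → ℝ := fun x g => F (x + a) g - F x g

omit [Fintype I] in
/-- [our object] Iterated differences along a list of steps (first step applied first).  A definition; asserts nothing. -/
def iterΔ : List Pt → (Pt → I → ℝ) → Pt → I → ℝ
  | [], F => F
  | a :: s, F => iterΔ s (fdiffB a F)

omit [Fintype I] in
/-- [our object] Unfolding. -/ @[simp] theorem shiftB_apply (a : Pt) (F : Pt → I → ℝ) (x : Pt) (g : I) : shiftB a F x g = F (x + a) g := rfl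
omit [Fintype I] in
/-- [our object] Unfolding. -/ @[simp] theorem fdiffB_apply (a : Pt) (F : Pt → I → ℝ) (x : Pt) (g : I) : fdiffB a F x g = F (x + a) g - F x g := rfl
omit [Fintype I] in
/-- [our object] Unfolding. -/ @[simp] theorem iterΔ_nil (F : Pt → I → ℝ) : iterΔ [] F = F := rfl
omit [Fintype I] in
/-- [our object] Unfolding. -/ @[simp] theorem iterΔ_cons (a : Pt) (s : List Pt) (F : Pt → I → ℝ) : iterΔ (a :: s) F = iterΔ s (fdiffB a F) := rfl

omit [Fintype I] in
/-- [folklore] Differences commute with shifts. -/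
theorem fdiffB_shiftB (a b : Pt) (F : Pt → I → ℝ) : fdiffB b (shiftB a F) = shiftB a (fdiffB b F) := by
  funext x g
  simp only [fdiffB_apply, shiftB_apply, add_right_comm x b a]

omit [Fintype I] in
/-- [folklore] Iterated differences commute with shifts. -/
theorem iterΔ_shiftB (s : List Pt) (a : Pt) (F : Pt → I → ℝ) : iterΔ s (shiftB a F) = shiftB a (iterΔ s F) := by
  induction s generalizing F with
  | nil => rfl
  | cons b s ih => rw [iterΔ_cons, iterΔ_cons, fdiffB_shiftB, ih]

/-- [our object] **THE LIST VERTEX FORM**: the located-pair list `L`, realised at the base point `z`, contracted with a ROW-end bond function `F`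
(at the row sites `z + x_p`, row indices) and a COLUMN-end bond function `G` (at `z + y_p`):
`vtx z L F G = Σ_{p ∈ L} Σ_g Σ_f p.m g f · F (z + p.x) g · G (z + p.y) f`.  A definition; asserts nothing. -/
def vtx (z : Pt) (L : Stn I) (F G : Pt → I → ℝ) : ℝ := (L.map fun p : LP I => ∑ g, ∑ f, p.m g f * F (z + p.x) g * G (z + p.y) f).sum

/-- [our object] Unfolding on the empty list. -/
@[simp] theorem vtx_nil (z : Pt) (F G : Pt → I → ℝ) : vtx z ([] : Stn I) F G = 0 := rfl

/-- [our object] Unfolding on a cons. -/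
theorem vtx_cons (z : Pt) (p : LP I) (L : Stn I) (F G : Pt → I → ℝ) :
    vtx z (p :: L) F G = (∑ g, ∑ f, p.m g f * F (z + p.x) g * G (z + p.y) f) + vtx z L F G := by
  simp [vtx]

/-- [folklore] Additivity in the list. -/
theorem vtx_append (z : Pt) (L L' : Stn I) (F G : Pt → I → ℝ) : vtx z (L ++ L') F G = vtx z L F G + vtx z L' F G := by
  simp [vtx, List.map_append, List.sum_append]

/-- [folklore] Homogeneity in the list. -/
theorem vtx_smulS (z : Pt) (c : ℝ) (L : Stn I) (F G : Pt → I → ℝ) : vtx z (smulS c L) F G = c * vtx z L F G := by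
  induction L with
  | nil => simp [vtx, smulS]
  | cons p L ih =>
    have e1 : smulS c (p :: L) = ⟨p.x, p.y, c • p.m⟩ :: smulS c L := rfl
    rw [e1, vtx_cons, vtx_cons, ih, mul_add, mul_sum]
    congr 1
    refine sum_congr rfl fun g _ => ?_
    rw [mul_sum]
    refine sum_congr rfl fun f _ => ?_
    dsimp only
    rw [Matrix.smul_apply, smul_eq_mul]; ring

/-- [folklore] A ROW SHIFT of the list shifts the row end. -/
theorem vtx_rowSh (z a : Pt) (L : Stn I) (F G : Pt → I → ℝ) : vtx z (rowSh a L) F G = vtx z L (shiftB a F) G := by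
  induction L with
  | nil => simp [vtx, rowSh]
  | cons p L ih =>
    have e1 : rowSh a (p :: L) = ⟨p.x + a, p.y, p.m⟩ :: rowSh a L := rfl
    rw [e1, vtx_cons, vtx_cons, ih]
    simp only [shiftB_apply, add_assoc]

/-- [folklore] A COLUMN SHIFT of the list shifts the column end. -/
theorem vtx_colSh (z a : Pt) (L : Stn I) (F G : Pt → I → ℝ) : vtx z (colSh a L) F G = vtx z L F (shiftB a G) := by
  induction L with
  | nil => simp [vtx, colSh]
  | cons p L ih =>
    have e1 : colSh a (p :: L) = ⟨p.x, p.y + a, p.m⟩ :: colSh a L := rfl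
    rw [e1, vtx_cons, vtx_cons, ih]
    simp only [shiftB_apply, add_assoc]

/-- [folklore] Linearity in the row end (differences). -/
theorem vtx_sub_left (z : Pt) (L : Stn I) (F F' G : Pt → I → ℝ) :
    vtx z L (fun x g => F x g - F' x g) G = vtx z L F G - vtx z L F' G := by
  induction L with
  | nil => simp
  | cons p L ih =>
    rw [vtx_cons, vtx_cons, vtx_cons, ih]
    have : (∑ g, ∑ f, p.m g f * (F (z + p.x) g - F' (z + p.x) g) * G (z + p.y) f)
        = (∑ g, ∑ f, p.m g f * F (z + p.x) g * G (z + p.y) f) - ∑ g, ∑ f, p.m g f * F' (z + p.x) g * G (z + p.y) f := by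
      rw [← sum_sub_distrib]; refine sum_congr rfl fun g _ => ?_
      rw [← sum_sub_distrib]; refine sum_congr rfl fun f _ => ?_; ring
    rw [this]; ring

/-- [folklore] Linearity in the column end (differences). -/
theorem vtx_sub_right (z : Pt) (L : Stn I) (F G G' : Pt → I → ℝ) :
    vtx z L F (fun x g => G x g - G' x g) = vtx z L F G - vtx z L F G' := by
  induction L with
  | nil => simp
  | cons p L ih =>
    rw [vtx_cons, vtx_cons, vtx_cons, ih]
    have : (∑ g, ∑ f, p.m g f * F (z + p.x) g * (G (z + p.y) f - G' (z + p.y) f))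
        = (∑ g, ∑ f, p.m g f * F (z + p.x) g * G (z + p.y) f) - ∑ g, ∑ f, p.m g f * F (z + p.x) g * G' (z + p.y) f := by
      rw [← sum_sub_distrib]; refine sum_congr rfl fun g _ => ?_
      rw [← sum_sub_distrib]; refine sum_congr rfl fun f _ => ?_; ring
    rw [this]; ring

/-- [folklore] **A ROW DIFFERENCE OF THE LIST IS A DIFFERENCE OF THE ROW END.** -/
theorem vtx_rowDiff (z a : Pt) (L : Stn I) (F G : Pt → I → ℝ) : vtx z (rowDiff a L) F G = vtx z L (fdiffB a F) G := by
  rw [rowDiff, vtx_append, vtx_rowSh, vtx_smulS]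
  rw [show fdiffB a F = fun x g => shiftB a F x g - F x g from rfl, vtx_sub_left]; ring

/-- [folklore] **A COLUMN DIFFERENCE OF THE LIST IS A DIFFERENCE OF THE COLUMN END.** -/
theorem vtx_colDiff (z a : Pt) (L : Stn I) (F G : Pt → I → ℝ) : vtx z (colDiff a L) F G = vtx z L F (fdiffB a G) := by
  rw [colDiff, vtx_append, vtx_colSh, vtx_smulS]
  rw [show fdiffB a G = fun x g => shiftB a G x g - G x g from rfl, vtx_sub_right]; ring

end Moves

/-! ## §2 The mixed two-leg bubble (list vertex against a rank-one partner) is the vertex form -/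

section Identity

/-- [our object] **THE VERTEX FORM OF A FINITELY SUPPORTED BOND KERNEL** over finite sets `S ⊇ rows`, `T ⊇ columns`:
`vform V S T F G = Σ_{s∈S} Σ_{y∈T} Σ_g Σ_f V s y g f · F s g · G y f`.  A definition; asserts nothing. -/
def vform (V : MKer 4 I) (S T : Finset Pt) (F G : Pt → I → ℝ) : ℝ := ∑ s ∈ S, ∑ y ∈ T, ∑ g, ∑ f, V s y g f * F s g * G y f

/-- [folklore] **A LEG THROUGH A FINITELY SUPPORTED KERNEL, APPLIED TO A BOND FUNCTION, IS THE VERTEX FORM IN THE ROW END `s ↦ A x s`**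
(`tsum_eq_sum` over the column support, `comp_eq_sum_of_rowSupp` over the row support; no summability hypothesis). -/
theorem applyK_comp_eq_vform (A V : MKer 4 I) {S T : Finset Pt} (hS : ∀ y z f b, y ∉ S → V y z f b = 0)
    (hT : ∀ y z f b, z ∉ T → V y z f b = 0) (G : Pt → I → ℝ) (x : Pt) (a : I) :
    applyK (comp A V) G x a = vform V S T (fun s g => A x s a g) G := by
  rw [applyK_apply, tsum_eq_sum (s := T)]
  · unfold vform
    conv_rhs => rw [Finset.sum_comm]
    refine sum_congr rfl fun y _ => ?_
    simp_rw [comp_eq_sum_of_rowSupp A V hS x y a, sum_mul]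
    rw [Finset.sum_comm]
    refine sum_congr rfl fun s _ => ?_
    rw [Finset.sum_comm]
    exact sum_congr rfl fun g _ => sum_congr rfl fun f _ => by ring
  · intro y hy
    exact sum_eq_zero fun b _ => by rw [comp_eq_zero_of_colSupp_right A V hT x y hy a b, zero_mul]

/-- [folklore] **THE MIXED TWO-LEG BUBBLE — a finitely supported vertex `V` against a RANK-ONE partner `φ ⊗ ψ` — IS THE VERTEX FORM with row end
`ψA` and column end `Bφ`**: `biBubble A V B (φ ⊗ ψ) = Σ_{s,y,g,f} V s y g f · (ψA)(s,g) · (Bφ)(y,f)`.  The rank-one pull-outs (`comp_outer_right` twice,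
`tr_outer`) are unconditional; the ONE exchange of the lattice series over the outer variable with the finite vertex sums uses the summability of the
row end `x ↦ Σ_a ψ x a · A x s a g` (`Summable.tsum_finsetSum`). -/
theorem biBubble_outer_right_eq_vform (A V B : MKer 4 I) {S T : Finset Pt} (hS : ∀ y z f b, y ∉ S → V y z f b = 0)
    (hT : ∀ y z f b, z ∉ T → V y z f b = 0) (φ ψ : Pt → I → ℝ) (hψA : ∀ (s : Pt) (g : I), Summable fun x : Pt => ∑ a, ψ x a * A x s a g) :
    biBubble A V B (outer φ ψ) = vform V S T (applyKT ψ A) (applyK B φ) := by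
  unfold PackedKernelSplit.biBubble
  rw [comp_outer_right B, comp_outer_right, tr_outer, pairing_def]
  set G : Pt → I → ℝ := applyK B φ with hG
  -- pointwise in the outer variable: the finite vertex sums with the fibre sum over `a` innermost
  have hpt : ∀ x : Pt, (∑ a, applyK (comp A V) G x a * ψ x a)
      = ∑ s ∈ S, ∑ y ∈ T, ∑ g, ∑ f, (V s y g f * G y f) * ∑ a, ψ x a * A x s a g := by
    intro x
    simp_rw [applyK_comp_eq_vform A V hS hT G x, vform, sum_mul, mul_sum]
    rw [sum_comm]
    refine sum_congr rfl fun s _ => ?_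
    rw [sum_comm]
    refine sum_congr rfl fun y _ => ?_
    rw [sum_comm]
    refine sum_congr rfl fun g _ => ?_
    rw [sum_comm]
    exact sum_congr rfl fun f _ => sum_congr rfl fun a _ => by ring
  simp_rw [hpt]
  have h1 : ∀ (s : Pt) (g : I) (c : ℝ), Summable fun x : Pt => c * ∑ a, ψ x a * A x s a g := fun s g c => (hψA s g).mul_left c
  have h2 : ∀ (s y : Pt) (g : I), Summable fun x : Pt => ∑ f, (V s y g f * G y f) * ∑ a, ψ x a * A x s a g :=
    fun s y g => summable_sum fun f _ => h1 s g _
  have h3 : ∀ (s y : Pt), Summable fun x : Pt => ∑ g, ∑ f, (V s y g f * G y f) * ∑ a, ψ x a * A x s a g :=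
    fun s y => summable_sum fun g _ => h2 s y g
  have h4 : ∀ s : Pt, Summable fun x : Pt => ∑ y ∈ T, ∑ g, ∑ f, (V s y g f * G y f) * ∑ a, ψ x a * A x s a g :=
    fun s => summable_sum fun y _ => h3 s y
  rw [Summable.tsum_finsetSum fun s _ => h4 s]
  unfold vform
  refine sum_congr rfl fun s _ => ?_
  rw [Summable.tsum_finsetSum fun y _ => h3 s y]
  refine sum_congr rfl fun y _ => ?_
  rw [Summable.tsum_finsetSum fun g _ => h2 s y g]
  refine sum_congr rfl fun g _ => ?_
  rw [Summable.tsum_finsetSum fun f _ => h1 s g _]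
  refine sum_congr rfl fun f _ => ?_
  rw [tsum_mul_left, applyKT_apply]; ring

/-- [folklore] Additivity of the vertex form in the kernel. -/
theorem vform_add (V V' : MKer 4 I) (S T : Finset Pt) (F G : Pt → I → ℝ) :
    vform (V + V') S T F G = vform V S T F G + vform V' S T F G := by
  simp only [vform, Pi.add_apply, add_mul, sum_add_distrib]

/-- [folklore] The vertex form of one elementary insertion inside the windows. -/
theorem vform_elemK {p q : Pt} {S T : Finset Pt} (hp : p ∈ S) (hq : q ∈ T) (m : I → I → ℝ) (F G : Pt → I → ℝ) :
    vform (elemK p q m) S T F G = ∑ g, ∑ f, m g f * F p g * G q f := by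
  unfold vform
  rw [sum_eq_single_of_mem p hp fun s _ hs => sum_eq_zero fun y _ => sum_eq_zero fun g _ => sum_eq_zero fun f _ => by
    rw [elemK_apply, if_neg fun h => hs h.1, zero_mul, zero_mul]]
  rw [sum_eq_single_of_mem q hq fun y _ hy => sum_eq_zero fun g _ => sum_eq_zero fun f _ => by
    rw [elemK_apply, if_neg fun h => hy h.2, zero_mul, zero_mul]]
  refine sum_congr rfl fun g _ => sum_congr rfl fun f _ => ?_
  rw [elemK_apply, if_pos ⟨rfl, rfl⟩]

/-- [folklore] **THE VERTEX FORM OF A REALISED LIST IS THE LIST VERTEX FORM** (windows containing the list's rows and columns). -/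
theorem vform_realK (z : Pt) (L : Stn I) {S T : Finset Pt} (hS : (L.map fun p : LP I => z + p.x).toFinset ⊆ S)
    (hT : (L.map fun p : LP I => z + p.y).toFinset ⊆ T) (F G : Pt → I → ℝ) : vform (realK z z L) S T F G = vtx z L F G := by
  induction L with
  | nil => simp [vform]
  | cons p L ih =>
    rw [List.map_cons, List.toFinset_cons, insert_subset_iff] at hS hT
    rw [realK_cons, vform_add, vform_elemK hS.1 hT.1, ih hS.2 hT.2, vtx_cons]

/-- [folklore] **THE MIXED BUBBLE OF A REALISED LIST AGAINST A RANK-ONE PARTNER IS THE LIST VERTEX FORM**: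
`biBubble A (realK z z L) B (φ ⊗ ψ) = vtx z L (ψA) (Bφ)` (one summability hypothesis on the row end). -/
theorem biBubble_realK_outer (A B : MKer 4 I) (z : Pt) (L : Stn I) (φ ψ : Pt → I → ℝ)
    (hψA : ∀ (s : Pt) (g : I), Summable fun x : Pt => ∑ a, ψ x a * A x s a g) :
    biBubble A (realK z z L) B (outer φ ψ) = vtx z L (applyKT ψ A) (applyK B φ) := by
  rw [biBubble_outer_right_eq_vform A (realK z z L) B (realK_rowSupp z z L) (realK_colSupp z z L) φ ψ hψA,
    vform_realK z L subset_rfl subset_rfl]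

end Identity

/-! ## §3 The graded unfolding: every derivation step of an3's `Graded` becomes a unit step at one END -/

section Unfold

/-- [our object] AN UNFOLDED TERM of the list vertex form: coefficient `c`, row ∕ column sites `x`, `y` (relative to the base point), fibre matrix `m`,
and the pending unit steps `sF` (differences of the ROW end) and `sG` (of the COLUMN end).  A definition; asserts nothing. -/
structure VTerm (I : Type*) where
  /-- coefficient -/ c : ℝ
  /-- row site -/ x : Pt
  /-- column site -/ y : Pt
  /-- fibre matrix -/ m : Matrix I I ℝ
  /-- steps on the row end -/ sF : List Pt
  /-- steps on the column end -/ sG : List Pt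

/-- [our object] Evaluation of an unfolded term: `c · Σ_{g f} m g f · (Δ_{sF} F)(z + x, g) · (Δ_{sG} G)(z + y, f)`.  A definition; asserts nothing. -/
def VTerm.eval (z : Pt) (F G : Pt → I → ℝ) (t : VTerm I) : ℝ :=
  t.c * ∑ g, ∑ f, t.m g f * iterΔ t.sF F (z + t.x) g * iterΔ t.sG G (z + t.y) f

omit [Fintype I] in
/-- [our object] Number of pending steps of an unfolded term.  A definition; asserts nothing. -/
def VTerm.len (t : VTerm I) : ℕ := t.sF.length + t.sG.length

/-- [folklore] **THE GRADED UNFOLDING (one list vertex)**: a list of grading `n` unfolds, for ALL base points and ALL pairs of end functions at once,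
into terms each carrying at least `n` unit steps (`IsStep`) distributed on the two ends — an3's `Graded` induction: `rowDiff` prepends a step to the
row end (`vtx_rowDiff`), `colDiff` to the column end, shifts move the sites (`iterΔ_shiftB`), `append` concatenates, `smul` rescales, `weaken` forgets. -/
theorem exists_vterms_of_graded {n : ℕ} {L : Stn I} (h : Graded n L) :
    ∃ Ts : List (VTerm I), (∀ t ∈ Ts, n ≤ t.len ∧ (∀ a ∈ t.sF, IsStep a) ∧ (∀ a ∈ t.sG, IsStep a)) ∧
      ∀ (z : Pt) (F G : Pt → I → ℝ), vtx z L F G = (Ts.map fun t => t.eval z F G).sum := by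
  induction h with
  | zero V =>
    refine ⟨V.map fun p => ⟨1, p.x, p.y, p.m, [], []⟩, fun t ht => ?_, fun z F G => ?_⟩
    · obtain ⟨p, _, rfl⟩ := List.mem_map.1 ht
      exact ⟨Nat.zero_le _, fun a ha => by simp at ha, fun a ha => by simp at ha⟩
    · induction V with
      | nil => simp
      | cons p V ih => rw [vtx_cons, List.map_cons, List.map_cons, List.sum_cons, ← ih]; simp [VTerm.eval]
  | weaken _ ih =>
    obtain ⟨Ts, hTs, hev⟩ := ih
    exact ⟨Ts, fun t ht => ⟨(Nat.le_succ _).trans (hTs t ht).1, (hTs t ht).2⟩, hev⟩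
  | @rowDiff n V a ha _ ih =>
    obtain ⟨Ts, hTs, hev⟩ := ih
    refine ⟨Ts.map fun t => { t with sF := a :: t.sF }, fun t ht => ?_, fun z F G => ?_⟩
    · obtain ⟨t', ht', rfl⟩ := List.mem_map.1 ht
      obtain ⟨hlen, hF, hG⟩ := hTs t' ht'
      refine ⟨?_, fun b hb => ?_, hG⟩
      · simp only [VTerm.len, List.length_cons] at hlen ⊢; omega
      · rcases List.mem_cons.1 hb with rfl | hb
        · exact ha
        · exact hF b hb
    · rw [vtx_rowDiff, hev z (fdiffB a F) G, List.map_map]; rfl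
  | @colDiff n V a ha _ ih =>
    obtain ⟨Ts, hTs, hev⟩ := ih
    refine ⟨Ts.map fun t => { t with sG := a :: t.sG }, fun t ht => ?_, fun z F G => ?_⟩
    · obtain ⟨t', ht', rfl⟩ := List.mem_map.1 ht
      obtain ⟨hlen, hF, hG⟩ := hTs t' ht'
      refine ⟨?_, hF, fun b hb => ?_⟩
      · simp only [VTerm.len, List.length_cons] at hlen ⊢; omega
      · rcases List.mem_cons.1 hb with rfl | hb
        · exact ha
        · exact hG b hb
    · rw [vtx_colDiff, hev z F (fdiffB a G), List.map_map]; rfl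
  | @rowSh n V a _ ih =>
    obtain ⟨Ts, hTs, hev⟩ := ih
    refine ⟨Ts.map fun t => { t with x := t.x + a }, fun t ht => ?_, fun z F G => ?_⟩
    · obtain ⟨t', ht', rfl⟩ := List.mem_map.1 ht
      exact hTs t' ht'
    · rw [vtx_rowSh, hev z (shiftB a F) G, List.map_map]
      refine congrArg List.sum (List.map_congr_left fun t _ => ?_)
      simp only [Function.comp_apply, VTerm.eval, iterΔ_shiftB, shiftB_apply, add_assoc]
  | @colSh n V a _ ih =>
    obtain ⟨Ts, hTs, hev⟩ := ih
    refine ⟨Ts.map fun t => { t with y := t.y + a }, fun t ht => ?_, fun z F G => ?_⟩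
    · obtain ⟨t', ht', rfl⟩ := List.mem_map.1 ht
      exact hTs t' ht'
    · rw [vtx_colSh, hev z F (shiftB a G), List.map_map]
      refine congrArg List.sum (List.map_congr_left fun t _ => ?_)
      simp only [Function.comp_apply, VTerm.eval, iterΔ_shiftB, shiftB_apply, add_assoc]
  | append _ _ ih₁ ih₂ =>
    obtain ⟨Ts₁, hTs₁, hev₁⟩ := ih₁
    obtain ⟨Ts₂, hTs₂, hev₂⟩ := ih₂
    refine ⟨Ts₁ ++ Ts₂, fun t ht => ?_, fun z F G => ?_⟩
    · rcases List.mem_append.1 ht with ht | ht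
      · exact hTs₁ t ht
      · exact hTs₂ t ht
    · rw [vtx_append, hev₁, hev₂, List.map_append, List.sum_append]
  | @smul n V c _ ih =>
    obtain ⟨Ts, hTs, hev⟩ := ih
    refine ⟨Ts.map fun t => { t with c := c * t.c }, fun t ht => ?_, fun z F G => ?_⟩
    · obtain ⟨t', ht', rfl⟩ := List.mem_map.1 ht
      exact hTs t' ht'
    · rw [vtx_smulS, hev z F G, List.map_map, ← List.sum_map_mul_left]
      refine congrArg List.sum (List.map_congr_left fun t _ => ?_)
      simp only [Function.comp_apply, VTerm.eval, mul_assoc]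

end Unfold

end Summit.QuantumFields.BalabanUV.Beta.D1BFx.LocalVertexForm
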